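/-
Copyright: the b2b-balaban T⁴-continuum CRUX team, row NE7b OWNER lineage `t4-ne7b-p1` (gen 140). Project licence.
-/
import Summits.QuantumFields.BalabanUV.T4Continuum.Spine.NE7b.SupWhitenedMomentLetters
import Summits.QuantumFields.BalabanUV.T4Continuum.Spine.NE7b.SupBlockHessianEntryLetter

/-!
# THE OUTPUT HESSIAN'S KERNEL AND ENTRY LETTERS FOR A GENERAL FLUCTUATION COVARIANCE `Γ = AAᵀ` (SCOPING (d11)(3) CLOSED — the whitened
# twins of (452) and (454)): the `Y`-stable `C²` block class tilted against `N(0, AAᵀ)` (`A : ι × κ` any factor; `Γ` possibly singular —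
# the road's finite-range decomposed fluctuation covariance) has, with NO precision condition and NO moment hypothesis,
#   KERNEL LETTER  `Σ_y |HessW(ψ)[e_x,e_y]| ≤ κr + (hr·αr)(αc·hc)(1−γ)⁻¹(1−γ′)⁻¹∕(1−lamA)`,
#   ENTRY MAJORANT `|HessW(ψ)[e_x,e_y]| ≤ Hk_{yx} + Σ_w (Dᵀa^x)_w(Dᵀa^y)_w∕(1−lamA)`  for every `D ≥ 0` with `I + D·C ≤ D`,
# where `a^x_w = Σ_u|A_{uw}|Hk_{xu}` and `C_{xw} = HA_{xw}∕(1−lamA)` off the diagonal (`HA` the whitened cross majorant of (456)) — uniformly in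
# the background `ψ` and in the volume; the hypotheses are the class letters (stability `κ₀`, gradient letter `κ₁, a`, `‖U″‖ ≤ κ₂`, the
# input kernel's row letter `κr` and entrywise majorant `Hk` with rows `hr`∕columns `hc`), the road's operator letter `(γ_op·1 − AAᵀ) ⪰ 0`
# with its regulator `(2κ₀(1+τ)+4δ)γ_op ≤ θ < 1`, the whitened regulator `2κ₀(1+τ)γ_op + 4δ ≤ θ`, the factor's `ℓ¹` letters `αr, αc`, the
# diagonal letter `lamA < 1` and the SMALLNESS `αc·hr·αr ≤ γ(1−lamA)`, `αc·hc·αr ≤ γ′(1−lamA)` (row NE7b, node U5c; (439), (403), (437),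
# (454) `regulator_drop`, (457), (458) BY NAME; [folklore])

Cell `pub-balaban`, sub-cell `t4`, spine estimate NE7b (`T4WeightBudget.RelWeightBound`; the cell's OWN estimate — NOT PRINTED in
[Bałaban 1983–89], NOT PROVED).  Crux-route work under `Spine/NE7b/` by the row OWNER (`t4-ne7b-p1` gen 140, file (459)) under FREEZE
(0)'s crux-prover clause; NOTHING of Bałaban's is named as a Lean object, valued or asserted; no `T4Continuum/Support` leaf typed; no
`def`, no notation; zero `sorry`.  Imports (BY NAME): the OWNER's (458) `…SupWhitenedMomentLetters` (`posSemidef_AAT`, `whitened_exp_integrable`,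
`whitened_second_moment_integrable`, `whitened_class_cov_kernel_rowsum_le`; through it (457) `whitened_cov_entry_le_raw`, the bridges),
(454) `…SupBlockHessianEntryLetter` (`regulator_drop`; through it (439) `hessian_entry_split`, `hessian_kernel_rowsum_split`, (437)
`rowsum_of_weighted_average`, `integrable_weighted_hessian_entry`, (403) `hessian_block_neg_log_apply`, (410) `block_Z_pos`).

WHAT IS PROVED ([folklore]):
* §1 `tilted_average_entry_le_general` ((454) §1 for a general `Γ ⪰ 0`: `|A_{xy}(ψ)| ≤ Hk_{yx}`).
* §2 **`whitened_cov_entry_le`**: the tilted covariance ENTRY under `N(0,AAᵀ)`, any admissible `D`.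
* §3 **`whitened_hessian_entry_le`**: the output entry majorant.
* §4 **`whitened_hessian_kernel_rowsum_le`**: the output kernel letter.

HONEST (what this is NOT).  Letters of the SECOND-order output kernel only; third-order kernel letters ((d11)(4)) are NOT touched; the
choice of `D` (plain Neumann: row letters; (453)'s weighted Neumann: decay) and the factor `A` are inputs.  Scalar skeleton ((A3),
NC-NE7b-α UNRULED); nothing of Bałaban's asserted.  BY-NAME EFFECT ON THE WALL: NONE.  NE7b NOT PRINTED ∕ NOT PROVED; spine PROVED 0∕9;
rung (B)+1 — the programme's measures remain FINITE-torus statements; NOT the mass gap, NOT Clay.  HONEST DEPENDENCY: continuum YM on T⁴ ⇐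
BetaPertH ∧ nine spine estimates (0∕9 proved); BetaPertH ⇐ (D1) ∧ (D4) ∧ CAP+tail; G-an2-4 gates asym, D1 and NE2∕3∕4.
-/

set_option autoImplicit false
set_option maxSynthPendingDepth 2

noncomputable section

namespace Summit.QuantumFields.BalabanUV.T4Continuum.NE7b.SupWhitenedHessianKernelLetter

open MeasureTheory ProbabilityTheory Real Set Function Finset Matrix
open scoped BigOperators
open Literature.Probability.Distributions (matrixCLM)
open SupWhitenedMomentLetters (posSemidef_AAT whitened_exp_integrable whitened_second_moment_integrable whitened_class_cov_kernel_rowsum_le)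
open SupWhitenedCovarianceKernelLetter (whitened_cov_entry_le_raw whitened_tilted_eq_gauss whitened_integral_eq)
open SupWhitenedFirstOrderLetters (whitened_cross_nonneg whitened_J_rowsum_le)
open SupBlockHessianEntryLetter (regulator_drop)
open SupBlockHessianKernelSplit (hessian_entry_split hessian_kernel_rowsum_split)
open SupBlockHessianKernelAverage (rowsum_of_weighted_average integrable_weighted_hessian_entry)
open SupBlockEffectiveActionCovariance (hessian_block_neg_log_apply)
open SupBlockDressedStep (block_Z_pos)
open SupBlockEffectiveActionDerivative (integrable_exp_neg_block)

variable {ι κ : Type} [Fintype ι] [DecidableEq ι] [Fintype κ] [DecidableEq κ]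

variable {Γ : Matrix ι ι ℝ} {γop : ℝ} {U : EuclideanSpace ℝ ι → ℝ} {U' : EuclideanSpace ℝ ι → EuclideanSpace ℝ ι →L[ℝ] ℝ}
  {U'' : EuclideanSpace ℝ ι → EuclideanSpace ℝ ι →L[ℝ] EuclideanSpace ℝ ι →L[ℝ] ℝ} {κ₀ κ₁ κ₂ κr a τ δ θ : ℝ}
  {ψ : EuclideanSpace ℝ ι} {Hk : ι → ι → ℝ} {A : Matrix ι κ ℝ} {αr αc hr hc lamA γ γ' : ℝ} {D : κ → κ → ℝ}

/-! ## §1. The tilted average keeps an entrywise majorant (general `Γ ⪰ 0`) -/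

omit [Fintype κ] [DecidableEq κ] in
/-- **`|A_{xy}(ψ)| ≤ Hk_{yx}`** for any `Γ ⪰ 0` under the regulator ((454) §1 verbatim with `M⁻¹` replaced by `Γ`). [folklore] -/
theorem tilted_average_entry_le_general (hΓ : Γ.PosSemidef) (hΓop : (γop • (1 : Matrix ι ι ℝ) - Γ).PosSemidef) (Y : Finset ι)
    (hUd : ∀ φ : EuclideanSpace ℝ ι, HasFDerivAt U (U' φ) φ) (hU''c : Continuous U'') (hκ₀ : 0 ≤ κ₀) (hτ : 0 < τ) (hδ : 0 < δ)
    (hθ0 : 0 < θ) (hθ1 : θ < 1) (hκθ : (2 * κ₀ * (1 + τ) + 4 * δ) * γop ≤ θ)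
    (hstab : ∀ φ : EuclideanSpace ℝ ι, -(κ₀ * ∑ x ∈ Y, φ x ^ 2) ≤ U φ) (hU''b : ∀ φ : EuclideanSpace ℝ ι, ‖U'' φ‖ ≤ κ₂)
    (hHk : ∀ (φ : EuclideanSpace ℝ ι) (x z : ι), |U'' φ (EuclideanSpace.single z (1 : ℝ)) (EuclideanSpace.single x (1 : ℝ))| ≤ Hk x z)
    (ψ : EuclideanSpace ℝ ι) (x y : ι) :
    |(∫ ω : EuclideanSpace ℝ ι, exp (-U (ω + ψ)) ∂(multivariateGaussian 0 Γ))⁻¹ * ∫ ω : EuclideanSpace ℝ ι, exp (-U (ω + ψ)) * U'' (ω + ψ) (EuclideanSpace.single x (1 : ℝ)) (EuclideanSpace.single y (1 : ℝ)) ∂(multivariateGaussian 0 Γ)| ≤ Hk y x := by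
  have hUc : Continuous U := continuous_iff_continuousAt.2 fun φ => (hUd φ).continuousAt
  have hZ := block_Z_pos hΓ hΓop Y hUd hκ₀ hτ hδ hθ0 hθ1 hκθ hstab ψ
  have hI0 := integrable_exp_neg_block hΓ hΓop Y hUc.measurable hκ₀ hτ hθ1 (regulator_drop hκ₀ hτ hδ hθ0 hκθ) hstab ψ
  have hint := integrable_weighted_hessian_entry hΓ hΓop Y hUd hU''c hκ₀ hτ hδ hθ0 hθ1 hκθ hstab hU''b ψ x y
  have h := rowsum_of_weighted_average (multivariateGaussian 0 Γ) (fun ω : EuclideanSpace ℝ ι => exp (-U (ω + ψ)))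
    (fun (ω : EuclideanSpace ℝ ι) (_ : Unit) (_ : Unit) => U'' (ω + ψ) (EuclideanSpace.single x (1 : ℝ)) (EuclideanSpace.single y (1 : ℝ)))
    (fun ω => (exp_pos _).le) hI0 hZ (fun _ _ => hint) (fun ω _ => by simpa using hHk (ω + ψ) y x) ()
  simpa using h

/-! ## §2. The tilted covariance entry under `N(0, AAᵀ)` -/

/-- **THE COVARIANCE ENTRY UNDER `N(0,AAᵀ)`, ANY ADMISSIBLE `D`**: `|C_{xy}(ψ)| ≤ Σ_w (Dᵀa^x)_w(Dᵀa^y)_w∕(1−lamA)` with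
`a^x_w = Σ_u|A_{uw}|Hk_{xu}`, for every `D ≥ 0` with `δ_{xy} + Σ_zD_{xz}C_{zy} ≤ D_{xy}` (`C_{zy} = HA_{zy}∕(1−lamA)` off the diagonal), under
the class's stability, the operator letter and the two regulators, the majorant's letters and the smallness `αc·hr·αr ≤ γ(1−lamA)`. [folklore] -/
theorem whitened_cov_entry_le [Nonempty κ] (hΓop : (γop • (1 : Matrix ι ι ℝ) - A * Aᵀ).PosSemidef) (Y : Finset ι)
    (hUd : ∀ φ : EuclideanSpace ℝ ι, HasFDerivAt U (U' φ) φ) (hU'd : ∀ φ : EuclideanSpace ℝ ι, HasFDerivAt U' (U'' φ) φ)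
    (hHk : ∀ (φ : EuclideanSpace ℝ ι) (x z : ι), |U'' φ (EuclideanSpace.single z (1 : ℝ)) (EuclideanSpace.single x (1 : ℝ))| ≤ Hk x z)
    (hHk0 : ∀ v u, 0 ≤ Hk v u) (hκ₀ : 0 ≤ κ₀) (hτ : 0 < τ) (hδ : 0 < δ) (hθ1 : θ < 1) (hκθ : 2 * κ₀ * (1 + τ) * γop ≤ θ)
    (hκθw : 2 * κ₀ * (1 + τ) * γop + 4 * δ ≤ θ) (hstab : ∀ φ : EuclideanSpace ℝ ι, -(κ₀ * ∑ x ∈ Y, φ x ^ 2) ≤ U φ) (ψ : EuclideanSpace ℝ ι)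
    (hαr : ∀ u, ∑ w, |A u w| ≤ αr) (hαc : ∀ w, ∑ u, |A u w| ≤ αc) (hhr : ∀ v, ∑ u, Hk v u ≤ hr)
    (hlam : ∀ x : κ, ∑ u, ∑ v, |A u x| * |A v x| * Hk v u ≤ lamA) (hlam1 : lamA < 1) (hγ : αc * hr * αr / (1 - lamA) ≤ γ) (hγ1 : γ < 1)
    (hD : ∀ x y, 0 ≤ D x y)
    (hDC : ∀ x y, (if x = y then (1 : ℝ) else 0) + ∑ z, D x z * ((if y = z then 0 else ∑ u, ∑ v, |A u y| * |A v z| * Hk v u) / (1 - lamA)) ≤ D x y)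
    (x y : ι) :
    |((∫ ω : EuclideanSpace ℝ ι, exp (-U (ω + ψ)) ∂(multivariateGaussian 0 (A * Aᵀ)))⁻¹ * (∫ ω : EuclideanSpace ℝ ι, exp (-U (ω + ψ)) * (U' (ω + ψ)
          (EuclideanSpace.single x (1 : ℝ)) * U' (ω + ψ) (EuclideanSpace.single y (1 : ℝ))) ∂(multivariateGaussian 0 (A * Aᵀ))) - ((∫ ω : EuclideanSpace ℝ ι, exp (-U (ω + ψ))
          ∂(multivariateGaussian 0 (A * Aᵀ))) ^ 2)⁻¹ * ((∫ ω : EuclideanSpace ℝ ι, exp (-U (ω + ψ)) * U' (ω + ψ) (EuclideanSpace.single x (1 : ℝ)) ∂(multivariateGaussian 0 (A * Aᵀ))) *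
          (∫ ω : EuclideanSpace ℝ ι, exp (-U (ω + ψ)) * U' (ω + ψ) (EuclideanSpace.single y (1 : ℝ)) ∂(multivariateGaussian 0 (A * Aᵀ)))))| ≤
      ∑ w, (∑ z, D z w * ∑ u, |A u z| * Hk x u) * (∑ z, D z w * ∑ u, |A u z| * Hk y u) / (1 - lamA) := by
  haveI : Nonempty ι := ⟨x⟩
  obtain ⟨w₀⟩ := ‹Nonempty κ›
  have hUc : Continuous U := continuous_iff_continuousAt.2 fun φ => (hUd φ).continuousAt
  have hU'c : Continuous U' := continuous_iff_continuousAt.2 fun φ => (hU'd φ).continuousAt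
  have hl1 : 0 < 1 - lamA := by linarith
  -- Dobrushin's row condition from the letters
  have hrow : ∀ x : κ, ∑ w, (if w = x then 0 else ∑ u, ∑ v, |A u w| * |A v x| * Hk v u) / (1 - lamA) ≤ γ := fun x => by
    rw [← Finset.sum_div]
    refine le_trans (div_le_div_of_nonneg_right ?_ hl1.le) hγ
    refine le_trans (Finset.sum_le_sum fun w _ => ?_) (whitened_J_rowsum_le hHk0 hαr hαc hhr x)
    split_ifs
    · exact le_rfl
    · linarith [abs_nonneg ((1 : Matrix κ κ ℝ) x w)]
  have hγ0 : 0 ≤ γ := by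
    refine le_trans (Finset.sum_nonneg fun w _ => div_nonneg ?_ hl1.le) (hrow w₀)
    split_ifs
    · exact le_rfl
    · exact whitened_cross_nonneg hHk0 A w₀ w
  -- the moment letters ((458))
  have hI0 := whitened_exp_integrable hΓop Y hUc.measurable hκ₀ hτ hθ1 hκθ hstab ψ
  have hI2 := fun w => whitened_second_moment_integrable hΓop Y hUc.measurable hκ₀ hτ hδ hθ1 hκθw hstab ψ w
  -- (457) §3 for the written-out sampler
  have h := whitened_cov_entry_le_raw hUd hU'd hHk hHk0 A ψ
    (P := fun x F ω => (∫ s, F (update ω x s) * exp (-(1 / 2 * (update ω x s ⬝ᵥ update ω x s) + U (matrixCLM A (WithLp.toLp 2 (update ω x s)) + ψ)))) /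
      ∫ s, exp (-(1 / 2 * (update ω x s ⬝ᵥ update ω x s) + U (matrixCLM A (WithLp.toLp 2 (update ω x s)) + ψ))))
    (fun _ _ _ => rfl) hlam hlam1 hrow hγ0 hγ1 hD hDC hI0 hI2 x y
  -- measurability of the integrands (all continuous)
  have hsh : Continuous fun ω : EuclideanSpace ℝ ι => ω + ψ := continuous_id.add continuous_const
  have he : Continuous fun ω : EuclideanSpace ℝ ι => exp (-U (ω + ψ)) := continuous_exp.comp (hUc.comp hsh).neg
  have hg : ∀ v : ι, Continuous fun ω : EuclideanSpace ℝ ι => U' (ω + ψ) (EuclideanSpace.single v (1 : ℝ)) := fun v =>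
    (hU'c.comp hsh).clm_apply continuous_const
  have hm0 : AEStronglyMeasurable (fun ω : EuclideanSpace ℝ ι => exp (-U (ω + ψ))) (multivariateGaussian 0 (A * Aᵀ)) := he.aestronglyMeasurable
  have hm1 : ∀ v : ι, AEStronglyMeasurable (fun ω : EuclideanSpace ℝ ι => exp (-U (ω + ψ)) * U' (ω + ψ) (EuclideanSpace.single v (1 : ℝ)))
      (multivariateGaussian 0 (A * Aᵀ)) := fun v => (he.mul (hg v)).aestronglyMeasurable
  have hm2 : AEStronglyMeasurable (fun ω : EuclideanSpace ℝ ι => exp (-U (ω + ψ)) * (U' (ω + ψ) (EuclideanSpace.single x (1 : ℝ)) *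
      U' (ω + ψ) (EuclideanSpace.single y (1 : ℝ)))) (multivariateGaussian 0 (A * Aᵀ)) := (he.mul ((hg x).mul (hg y))).aestronglyMeasurable
  refine le_trans (le_of_eq ?_) h
  rw [whitened_tilted_eq_gauss A ψ, whitened_tilted_eq_gauss A ψ, whitened_tilted_eq_gauss A ψ]
  simp only [WithLp.toLp_ofLp]
  rw [whitened_integral_eq A hm0, whitened_integral_eq A hm2, whitened_integral_eq A (hm1 x), whitened_integral_eq A (hm1 y)]
  congr 1
  ring

/-! ## §3. The output Hessian's entrywise majorant under `N(0, AAᵀ)` -/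

/-- **THE OUTPUT ENTRY MAJORANT, GENERAL `Γ = AAᵀ`**: `|HessW(ψ)[e_x,e_y]| ≤ Hk_{yx} + Σ_w (Dᵀa^x)_w(Dᵀa^y)_w∕(1−lamA)` ((439)'s split, §1,
§2) — the letter that iterates, decaying with (453)'s weighted `D`; no precision condition, no moment hypothesis. [folklore] -/
theorem whitened_hessian_entry_le [Nonempty κ] (hΓop : (γop • (1 : Matrix ι ι ℝ) - A * Aᵀ).PosSemidef) (Y : Finset ι)
    (hUd : ∀ φ : EuclideanSpace ℝ ι, HasFDerivAt U (U' φ) φ) (hU'd : ∀ φ : EuclideanSpace ℝ ι, HasFDerivAt U' (U'' φ) φ)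
    (hU''c : Continuous U'') (hκ₀ : 0 ≤ κ₀) (hκ₁ : 0 ≤ κ₁) (ha : 0 ≤ a) (hκ₂ : 0 ≤ κ₂) (hτ : 0 < τ) (hδ : 0 < δ) (hθ0 : 0 < θ) (hθ1 : θ < 1)
    (hκθ : (2 * κ₀ * (1 + τ) + 4 * δ) * γop ≤ θ) (hκθw : 2 * κ₀ * (1 + τ) * γop + 4 * δ ≤ θ)
    (hstab : ∀ φ : EuclideanSpace ℝ ι, -(κ₀ * ∑ x ∈ Y, φ x ^ 2) ≤ U φ)
    (hU'b : ∀ φ : EuclideanSpace ℝ ι, ‖U' φ‖ ≤ κ₁ * (a + ∑ x ∈ Y, φ x ^ 2)) (hU''b : ∀ φ : EuclideanSpace ℝ ι, ‖U'' φ‖ ≤ κ₂)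
    (hHk : ∀ (φ : EuclideanSpace ℝ ι) (x z : ι), |U'' φ (EuclideanSpace.single z (1 : ℝ)) (EuclideanSpace.single x (1 : ℝ))| ≤ Hk x z)
    (hHk0 : ∀ v u, 0 ≤ Hk v u) (ψ : EuclideanSpace ℝ ι)
    (hαr : ∀ u, ∑ w, |A u w| ≤ αr) (hαc : ∀ w, ∑ u, |A u w| ≤ αc) (hhr : ∀ v, ∑ u, Hk v u ≤ hr)
    (hlam : ∀ x : κ, ∑ u, ∑ v, |A u x| * |A v x| * Hk v u ≤ lamA) (hlam1 : lamA < 1) (hγ : αc * hr * αr / (1 - lamA) ≤ γ) (hγ1 : γ < 1)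
    (hD : ∀ x y, 0 ≤ D x y)
    (hDC : ∀ x y, (if x = y then (1 : ℝ) else 0) + ∑ z, D x z * ((if y = z then 0 else ∑ u, ∑ v, |A u y| * |A v z| * Hk v u) / (1 - lamA)) ≤ D x y)
    (x y : ι) :
    |((∫ ω : EuclideanSpace ℝ ι, exp (-U (ω + ψ)) ∂(multivariateGaussian 0 (A * Aᵀ)))⁻¹ • (∫ ω : EuclideanSpace ℝ ι, exp (-U (ω + ψ)) • (U'' (ω + ψ) - (U' (ω +
        ψ)).smulRight (U' (ω + ψ))) ∂(multivariateGaussian 0 (A * Aᵀ))) + (((∫ ω : EuclideanSpace ℝ ι, exp (-U (ω + ψ)) ∂(multivariateGaussian 0 (A * Aᵀ))) ^ 2)⁻¹ • ∫ ω :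
        EuclideanSpace ℝ ι, exp (-U (ω + ψ)) • U' (ω + ψ) ∂(multivariateGaussian 0 (A * Aᵀ))).smulRight (∫ ω : EuclideanSpace ℝ ι, exp (-U (ω + ψ)) • U' (ω + ψ)
        ∂(multivariateGaussian 0 (A * Aᵀ)))) (EuclideanSpace.single x (1 : ℝ)) (EuclideanSpace.single y (1 : ℝ))| ≤
      Hk y x + ∑ w, (∑ z, D z w * ∑ u, |A u z| * Hk x u) * (∑ z, D z w * ∑ u, |A u z| * Hk y u) / (1 - lamA) := by
  have hΓ : (A * Aᵀ).PosSemidef := posSemidef_AAT A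
  have h1 := tilted_average_entry_le_general hΓ hΓop Y hUd hU''c hκ₀ hτ hδ hθ0 hθ1 hκθ hstab hU''b hHk ψ x y
  have h2 := whitened_cov_entry_le hΓop Y hUd hU'd hHk hHk0 hκ₀ hτ hδ hθ1 (regulator_drop hκ₀ hτ hδ hθ0 hκθ) hκθw hstab ψ hαr hαc hhr hlam
    hlam1 hγ hγ1 hD hDC x y
  rw [hessian_block_neg_log_apply hΓ hΓop Y hUd hU'd hU''c hκ₀ hκ₁ ha hκ₂ hτ hδ hθ1 hκθ hstab hU'b hU''b ψ _ _,
    hessian_entry_split hΓ hΓop Y hUd hU'd hU''c hκ₀ hκ₁ ha hκ₂ hτ hδ hθ0 hθ1 hκθ hstab hU'b hU''b ψ x y]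
  exact (abs_sub _ _).trans (add_le_add h1 h2)

/-! ## §4. The output Hessian's kernel letter under `N(0, AAᵀ)` -/

/-- **THE OUTPUT HESSIAN KERNEL LETTER, GENERAL `Γ = AAᵀ`**: `Σ_y |HessW(ψ)[e_x,e_y]| ≤ κr + (hr·αr)·(αc·hc)·(1−γ)⁻¹(1−γ′)⁻¹∕(1−lamA)` for
every background `ψ` and site `x`, under the class letters, the operator letter with the two regulators, the factor's letters and the
smallness — no precision condition ((439) `hessian_kernel_rowsum_split` ⊕ (458)). [folklore] -/
theorem whitened_hessian_kernel_rowsum_le [Nonempty κ] (hΓop : (γop • (1 : Matrix ι ι ℝ) - A * Aᵀ).PosSemidef) (Y : Finset ι)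
    (hUd : ∀ φ : EuclideanSpace ℝ ι, HasFDerivAt U (U' φ) φ) (hU'd : ∀ φ : EuclideanSpace ℝ ι, HasFDerivAt U' (U'' φ) φ)
    (hU''c : Continuous U'') (hκ₀ : 0 ≤ κ₀) (hκ₁ : 0 ≤ κ₁) (ha : 0 ≤ a) (hκ₂ : 0 ≤ κ₂) (hτ : 0 < τ) (hδ : 0 < δ) (hθ0 : 0 < θ) (hθ1 : θ < 1)
    (hκθ : (2 * κ₀ * (1 + τ) + 4 * δ) * γop ≤ θ) (hκθw : 2 * κ₀ * (1 + τ) * γop + 4 * δ ≤ θ)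
    (hstab : ∀ φ : EuclideanSpace ℝ ι, -(κ₀ * ∑ x ∈ Y, φ x ^ 2) ≤ U φ)
    (hU'b : ∀ φ : EuclideanSpace ℝ ι, ‖U' φ‖ ≤ κ₁ * (a + ∑ x ∈ Y, φ x ^ 2)) (hU''b : ∀ φ : EuclideanSpace ℝ ι, ‖U'' φ‖ ≤ κ₂)
    (hU''row : ∀ (φ : EuclideanSpace ℝ ι) (x : ι), ∑ y, |U'' φ (EuclideanSpace.single x (1 : ℝ)) (EuclideanSpace.single y (1 : ℝ))| ≤ κr)
    (hHk : ∀ (φ : EuclideanSpace ℝ ι) (x z : ι), |U'' φ (EuclideanSpace.single z (1 : ℝ)) (EuclideanSpace.single x (1 : ℝ))| ≤ Hk x z)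
    (hHk0 : ∀ v u, 0 ≤ Hk v u) (ψ : EuclideanSpace ℝ ι)
    (hαr : ∀ u, ∑ w, |A u w| ≤ αr) (hαc : ∀ w, ∑ u, |A u w| ≤ αc) (hhr : ∀ v, ∑ u, Hk v u ≤ hr) (hhc : ∀ u, ∑ v, Hk v u ≤ hc)
    (hlam : ∀ x : κ, ∑ u, ∑ v, |A u x| * |A v x| * Hk v u ≤ lamA) (hlam1 : lamA < 1)
    (hγ : αc * hr * αr / (1 - lamA) ≤ γ) (hγ1 : γ < 1) (hγ' : αc * hc * αr / (1 - lamA) ≤ γ') (hγ'1 : γ' < 1) (x : ι) :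
    ∑ y, |((∫ ω : EuclideanSpace ℝ ι, exp (-U (ω + ψ)) ∂(multivariateGaussian 0 (A * Aᵀ)))⁻¹ • (∫ ω : EuclideanSpace ℝ ι, exp (-U (ω + ψ)) • (U'' (ω + ψ) - (U' (ω +
        ψ)).smulRight (U' (ω + ψ))) ∂(multivariateGaussian 0 (A * Aᵀ))) + (((∫ ω : EuclideanSpace ℝ ι, exp (-U (ω + ψ)) ∂(multivariateGaussian 0 (A * Aᵀ))) ^ 2)⁻¹ • ∫ ω :
        EuclideanSpace ℝ ι, exp (-U (ω + ψ)) • U' (ω + ψ) ∂(multivariateGaussian 0 (A * Aᵀ))).smulRight (∫ ω : EuclideanSpace ℝ ι, exp (-U (ω + ψ)) • U' (ω + ψ)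
        ∂(multivariateGaussian 0 (A * Aᵀ)))) (EuclideanSpace.single x (1 : ℝ)) (EuclideanSpace.single y (1 : ℝ))| ≤
      κr + hr * αr * (αc * hc) * (1 - γ)⁻¹ * (1 - γ')⁻¹ / (1 - lamA) := by
  have hΓ : (A * Aᵀ).PosSemidef := posSemidef_AAT A
  have h1 := hessian_kernel_rowsum_split hΓ hΓop Y hUd hU'd hU''c hκ₀ hκ₁ ha hκ₂ hτ hδ hθ0 hθ1 hκθ hstab hU'b hU''b hU''row ψ x
  have h2 := whitened_class_cov_kernel_rowsum_le hΓop Y hUd hU'd hHk hHk0 hκ₀ hτ hδ hθ1 (regulator_drop hκ₀ hτ hδ hθ0 hκθ) hκθw hstab ψ hαr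
    hαc hhr hhc hlam hlam1 hγ hγ1 hγ' hγ'1 x
  linarith

end Summit.QuantumFields.BalabanUV.T4Continuum.NE7b.SupWhitenedHessianKernelLetter

end
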